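import Summits.CriticalPhenomena.Ising3DConformalLimit.Theorems.MoebiusLimitOfTwoPointLaw.Negative.TwoPointConvergence

/-!
# `MoebiusLimitOfTwoPointLaw` (crux `stmt-CriticalPhenomena-4801`): REDUCTION TO THE EVEN ARITIES `n ≥ 4`
# (negative-side support; the irreducible content of the crux, kernel-checked)

Support file of the crux disprover (cdisprove seat, cycle 2); companion of `CanonicalForm.lean` and
`TwoPointConvergence.lean`. Main theorem `moebiusLimitOfTwoPointLaw_iff_even`:

  the crux holds iff for every witness `(Δ, c)` of item 0634 there is a Möbius-covariant family `T` of
  dimension `Δ` whose even arities `n ≥ 4` are the locally uniform limits, off the diagonals, of the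
  canonically renormalised critical correlators `δ^{-nΔ}⟨σ_{[x₁/δ]}⋯σ_{[xₙ/δ]}⟩_{β_c}`.

Nothing else is asked of `T` (its arities `0, 2` and odd are discarded and replaced by `1`, `c‖x₀−x₁‖^{-2Δ}`, `0`,
which item 0634 delivers: `TwoPointConvergence.lean`), and nothing less suffices (canonical form,
`CanonicalForm.lean`). In words: given the two-point law, item 1344 = existence of the even `n ≥ 4` scaling
limits along the full filter with `ρ = δ^{-Δ}` + their Euclidean invariance, scale covariance with the two-point
exponent and inversion covariance. `sorry`-free.
-/

noncomputable section

namespace Summit.CriticalPhenomena.Ising3DConformalLimit.Theorems.MoebiusLimitOfTwoPointLaw.Negative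

open Literature.Probability.LatticeModels Filter Topology
open Literature.Barriers.CriticalPhenomena.ScaleNotMoebius (twoPt twoPt_pos twoPt_add twoPt_map twoPt_smul
  twoPt_inversion injective_fin_two_iff)
open Summit.CriticalPhenomena.Ising3DConformalLimit.Theses.PrecisionLaplacian (MoebiusLimitOfTwoPointLaw)

/-- Assemble a full family from its even arities `n ≥ 4`: arity `0` ↦ `1`, arity `2` ↦ `c‖x₀ − x₁‖^{-2Δ}`,
odd arities ↦ `0`, even arities `n ≥ 4` ↦ `T n`. -/
def assemble (c Δ : ℝ) (T : CorrFamily 3) : CorrFamily 3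
  | 0 => fun _ => 1
  | 1 => fun _ => 0
  | 2 => fun x => c * twoPt Δ (x 0) (x 1)
  | (n + 3) => if Odd (n + 3) then fun _ => 0 else T (n + 3)

/-- Arity `0` of the assembled family. -/
theorem assemble_zero (c Δ : ℝ) (T : CorrFamily 3) (x : Fin 0 → EuclideanSpace ℝ (Fin 3)) :
    assemble c Δ T 0 x = 1 := rfl

/-- Arity `2` of the assembled family. -/
theorem assemble_two (c Δ : ℝ) (T : CorrFamily 3) (x : Fin 2 → EuclideanSpace ℝ (Fin 3)) :
    assemble c Δ T 2 x = c * twoPt Δ (x 0) (x 1) := rfl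

/-- Odd arities of the assembled family vanish. -/
theorem assemble_odd (c Δ : ℝ) (T : CorrFamily 3) {n : ℕ} (hn : Odd n) (x : Fin n → EuclideanSpace ℝ (Fin 3)) :
    assemble c Δ T n x = 0 := by
  match n, hn with
  | 0, h => exact absurd h (by decide)
  | 1, _ => rfl
  | 2, h => exact absurd h (by decide)
  | (m + 3), h => simp [assemble, h]

/-- Even arities `≥ 4` of the assembled family are those of `T`. -/
theorem assemble_even (c Δ : ℝ) (T : CorrFamily 3) {n : ℕ} (hn : Even n) (h4 : 4 ≤ n)
    (x : Fin n → EuclideanSpace ℝ (Fin 3)) : assemble c Δ T n x = T n x := by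
  obtain ⟨m, rfl⟩ : ∃ m, n = m + 3 := ⟨n - 3, by omega⟩
  have h' : ¬ Odd (m + 3) := Nat.not_odd_iff_even.2 hn
  simp [assemble, h']

/-- The assembled family inherits Möbius covariance from `T`. -/
theorem isMoebiusCovariant_assemble (c : ℝ) {Δ : ℝ} {T : CorrFamily 3} (hT : IsMoebiusCovariant Δ T) :
    IsMoebiusCovariant Δ (assemble c Δ T) := by
  obtain ⟨⟨ht, hr⟩, hs, hi⟩ := hT
  -- arity dispatcher
  have key : ∀ n : ℕ, n = 0 ∨ n = 2 ∨ Odd n ∨ (Even n ∧ 4 ≤ n) := by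
    intro n
    rcases Nat.even_or_odd n with he | ho
    · rcases Nat.lt_or_ge n 4 with hlt | hge
      · interval_cases n
        · exact Or.inl rfl
        · exact absurd he (by decide)
        · exact Or.inr (Or.inl rfl)
        · exact absurd he (by decide)
      · exact Or.inr (Or.inr (Or.inr ⟨he, hge⟩))
    · exact Or.inr (Or.inr (Or.inl ho))
  refine ⟨⟨fun n v x => ?_, fun n R x => ?_⟩, fun n a ha x => ?_, fun n x hx => ?_⟩
  · rcases key n with h0 | h2 | ho | ⟨he, h4⟩
    · subst h0; rfl
    · subst h2; rw [assemble_two, assemble_two, twoPt_add]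
    · rw [assemble_odd c Δ T ho, assemble_odd c Δ T ho]
    · rw [assemble_even c Δ T he h4, assemble_even c Δ T he h4, ht n v x]
  · rcases key n with h0 | h2 | ho | ⟨he, h4⟩
    · subst h0; rfl
    · subst h2; rw [assemble_two, assemble_two, twoPt_map]
    · rw [assemble_odd c Δ T ho, assemble_odd c Δ T ho]
    · rw [assemble_even c Δ T he h4, assemble_even c Δ T he h4, hr n R x]
  · rcases key n with h0 | h2 | ho | ⟨he, h4⟩
    · subst h0; rw [assemble_zero, assemble_zero]; simp
    · subst h2
      rw [assemble_two, assemble_two, twoPt_smul Δ ha]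
      have e : (-((2 : ℕ) : ℝ) * Δ) = -(2 * Δ) := by push_cast; ring
      rw [e]; ring
    · rw [assemble_odd c Δ T ho, assemble_odd c Δ T ho, mul_zero]
    · rw [assemble_even c Δ T he h4, assemble_even c Δ T he h4, hs n a ha x]
  · rcases key n with h0 | h2 | ho | ⟨he, h4⟩
    · subst h0; rw [assemble_zero, assemble_zero]; simp
    · subst h2
      rw [assemble_two, assemble_two, twoPt_inversion Δ (hx 0) (hx 1), Fin.prod_univ_two]
      ring
    · rw [assemble_odd c Δ T ho, assemble_odd c Δ T ho, mul_zero]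
    · rw [assemble_even c Δ T he h4, assemble_even c Δ T he h4, hi n x hx]

/-- The assembled family has non-degenerate two-point function (`0 < c`). -/
theorem isNondegenerateTwoPoint_assemble {c : ℝ} (hc : 0 < c) (Δ : ℝ) (T : CorrFamily 3) :
    IsNondegenerateTwoPoint (assemble c Δ T) := by
  intro x hx
  rw [assemble_two]
  exact mul_pos hc (twoPt_pos Δ ((injective_fin_two_iff x).1 ((mem_nonCoincident x).1 hx)))

/-- Under the two-point law, the assembled family IS the canonical scaling limit as soon as its even arities
`n ≥ 4` are. -/
theorem hasPointwiseScalingLimit_assemble {Δ c : ℝ} (hc : 0 < c)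
    (hP : Tendsto (fun x : Site 3 =>
      criticalTwoPoint 3 x * Real.sqrt (∑ i, ((x i : ℝ)) ^ 2) ^ (2 * Δ)) cofinite (nhds c))
    {T : CorrFamily 3}
    (hT : ∀ n, 4 ≤ n → Even n → TendstoLocallyUniformlyOn
      (rescaledCorrelator (criticalCorr 3) (fun δ => δ ^ (-Δ)) n) (T n) (𝓝[>] (0 : ℝ)) (NonCoincident 3 n)) :
    HasPointwiseScalingLimit (criticalCorr 3) (fun δ => δ ^ (-Δ)) (assemble c Δ T) := by
  intro n
  rcases Nat.even_or_odd n with he | ho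
  · rcases Nat.lt_or_ge n 4 with hlt | hge
    · interval_cases n
      · exact (tendstoLocallyUniformlyOn_arity_zero _).congr_right fun x _ => (assemble_zero c Δ T x).symm
      · exact absurd he (by decide)
      · exact (tendstoLocallyUniformlyOn_arity_two_of_twoPointLaw hc hP).congr_right
          fun x _ => (assemble_two c Δ T x).symm
      · exact absurd he (by decide)
    · exact (hT n hge he).congr_right fun x _ => (assemble_even c Δ T he hge x).symm
  · exact (tendstoLocallyUniformlyOn_arity_odd _ ho).congr_right fun x _ => (assemble_odd c Δ T ho x).symm

/-- **Reduction of the crux to the even arities `n ≥ 4`.** `MoebiusLimitOfTwoPointLaw` holds iff for every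
witness `(Δ, c)` of item 0634 there is a Möbius-covariant family `T` of dimension `Δ` such that, for every EVEN
`n ≥ 4`, `δ^{-nΔ}⟨σ_{[x₁/δ]}⋯σ_{[xₙ/δ]}⟩_{β_c} → T_n` locally uniformly off the diagonals as `δ → 0⁺`. -/
theorem moebiusLimitOfTwoPointLaw_iff_even :
    MoebiusLimitOfTwoPointLaw ↔
      ∀ Δ c : ℝ, 0 < c →
        Tendsto (fun x : Site 3 =>
          criticalTwoPoint 3 x * Real.sqrt (∑ i, ((x i : ℝ)) ^ 2) ^ (2 * Δ)) cofinite (nhds c) →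
        ∃ T : CorrFamily 3, IsMoebiusCovariant Δ T ∧
          ∀ n, 4 ≤ n → Even n → TendstoLocallyUniformlyOn
            (rescaledCorrelator (criticalCorr 3) (fun δ => δ ^ (-Δ)) n) (T n) (𝓝[>] (0 : ℝ))
            (NonCoincident 3 n) := by
  rw [moebiusLimitOfTwoPointLaw_iff_canonical]
  constructor
  · intro h Δ c hc hP
    obtain ⟨S, hlim, -, hM⟩ := h Δ c hc hP
    exact ⟨S, hM, fun n _ _ => hlim n⟩
  · intro h Δ c hc hP
    obtain ⟨T, hM, hT⟩ := h Δ c hc hP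
    exact ⟨assemble c Δ T, hasPointwiseScalingLimit_assemble hc hP hT,
      isNondegenerateTwoPoint_assemble hc Δ T, isMoebiusCovariant_assemble c hM⟩

end Summit.CriticalPhenomena.Ising3DConformalLimit.Theorems.MoebiusLimitOfTwoPointLaw.Negative

end
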